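import Mathlib
import HarnessLib
import Summits.Ventures.LatticeQCDFlow.Exactness.SphereTangentialLaplacian
import Summits.Ventures.LatticeQCDFlow.Exactness.SphereLOFlowAction
import Summits.Ventures.LatticeQCDFlow.Exactness.SphereLOFlowDivergence

/-!
# `div ∘ grad = Δ` on the site sphere in Engel–Schaefer's extension calculus: Lüscher's leading-order criterion and E–S eq. (15) are the same statement

HONEST FRAMING: exact (Metropolis-corrected) sampling algorithms for lattice gauge theory;
figures of merit are autocorrelation/cost numbers at stated couplings and volumes; no
continuum-physics claim.

Venture `LatticeQCDFlow` (cell pub-lqcd), topic `Exactness`; FANOUT row 7 (`s0-cpn-null`: the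
S0-D1 rung — 2D CP⁹, Lüscher's LO trivializing map inside HMC, Engel–Schaefer 2011).  NEW WORK of
the cell over Mathlib (`gradient`, `LinearMap.trace`, the Laplacian `Δ`) and the tree's
`SphereTangentialLaplacian.lean` (calculus of `ν = NormedSpace.normalize`, Euler identities),
`SphereLOFlowAction.lean` (`siteGrad`, `siteLaplacian`, `loFlowAction`, `loGenerator`) and
`SphereLOFlowDivergence.lean` (`sphereDiv`, `siteDiv`); nothing is cited as a fact.  Printed
counterparts, NAMED ONLY: Engel–Schaefer, Comput. Phys. Commun. 182 (2011) 2107, §2.2 eq. (12)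
(derivatives on the sphere via the extension `f̃(x) = f(x/|x|)`) and §3 eqs. (14)–(15) (the gradient
ansatz `T = −∂̃S̃`, the LO equation `−Σ∂̃·∂̃ S̃⁽⁰⁾ = S + C`); M. Lüscher, Commun. Math. Phys. 293 (2010)
899, §4.1–4.2 eqs. (4.3)–(4.5) ("with the ansatz `Z_t = −∂S̃_t` the differential condition (4.3)
becomes the Laplace equation (4.5)").

## Content (`E` a finite-dimensional real inner product space, `‖u‖ = 1`, `g = f ∘ ν` the
degree-`0` extension of `f`)

* `fderiv_comp_normalize_smul`, `gradient_comp_normalize_smul`, **`gradient_comp_normalize_normalize`**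
  — the derivative / gradient of a degree-`0` homogeneous function is homogeneous of degree `−1`:
  `∇g(t y) = t⁻¹ ∇g(y)` (`t > 0`), hence `∇g(y/‖y‖) = ‖y‖ ∇g(y)`.
* `hasFDerivAt_gradient` — `D(∇g)(u) = (toDual)⁻¹ ∘ D²g(u)`; `trace_toDual_symm_comp` — the trace of
  `(toDual)⁻¹ ∘ D²g(u)` is the flat Laplacian `Δg(u)`.
* **`sphereDiv_gradient_comp_normalize`** — `div ∘ grad = Δ` IN E–S's CALCULUS: the sphere
  divergence (`SphereLOFlowDivergence.sphereDiv`: trace of the derivative of the extension along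
  `ν`) of the natural gradient `∇g` equals `Δg(u)` (`= ∂̃·∂̃ f`, the operator of eq. (15)), for `f`
  of class `C²` at `u`.  The radial term `⟪u, ∇g(u)⟫` produced by the factor `‖y‖` vanishes by the
  Euler identity.
* **`siteDiv_siteGrad`** — sitewise: `div_n (∂̃_n φ) = ∂̃_n·∂̃_n φ`; **`siteDiv_loGenerator_eq_neg_siteLaplacian`**
  — for the Engel–Schaefer generator `T_n = −∂̃_n S̃⁽⁰⁾`: `div_n T_n = −∂̃_n·∂̃_n S̃⁽⁰⁾`, so Lüscher's
  criterion at `t = 0` (`Σ_n div_n T = S + Ċ₀`, `SphereLOFlowDivergence.sum_siteDiv_loGenerator`) and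
  E–S eq. (15) (`−Σ_n ∂̃_n·∂̃_n S̃⁽⁰⁾ = S + C`, `SphereLOFlowAction.neg_sum_siteLaplacian_loFlowAction`)
  are one statement; `sum_siteDiv_loGenerator'` re-derives the former from the latter.

NOT CLAIMED: anything beyond `C²` regularity bookkeeping; the Laplace–Beltrami operator of a
manifold library (none is used); higher orders of Lüscher's expansion; anything quantitative.
-/

noncomputable section

namespace Summit.Ventures.LatticeQCDFlow.Exactness

open NormedSpace Filter Laplacian InnerProductSpace
open scoped RealInnerProductSpace Topology Gradient

variable {E : Type*} [NormedAddCommGroup E] [InnerProductSpace ℝ E]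

/-! ## §1 The gradient of a degree-`0` homogeneous function is homogeneous of degree `−1` -/

section Homogeneity

variable {f : E → ℝ}

/-- The derivative of the extension `g = f ∘ ν` scales like `t⁻¹`: `Dg(t y) = t⁻¹ Dg(y)` for
`t > 0`, at any point where `g` is differentiable at `t y`. -/
theorem fderiv_comp_normalize_smul {t : ℝ} (ht : 0 < t) {y : E}
    (hg : DifferentiableAt ℝ (fun z => f (normalize z)) (t • y)) :
    fderiv ℝ (fun z => f (normalize z)) (t • y) = t⁻¹ • fderiv ℝ (fun z => f (normalize z)) y := by
  have h1 : (fun z : E => f (normalize z)) =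
      fun z => (fun w : E => f (normalize w)) ((t • ContinuousLinearMap.id ℝ E) z) := by
    funext z
    simp only [smul_apply, ContinuousLinearMap.id_apply, normalize_smul_of_pos ht]
  have hs : HasFDerivAt (fun z : E => (t • ContinuousLinearMap.id ℝ E) z)
      (t • ContinuousLinearMap.id ℝ E) y :=
    (t • ContinuousLinearMap.id ℝ E).hasFDerivAt
  have hg' : DifferentiableAt ℝ (fun w : E => f (normalize w)) ((t • ContinuousLinearMap.id ℝ E) y) := by
    simpa only [smul_apply, ContinuousLinearMap.id_apply] using hg
  have h2 : HasFDerivAt (fun z => (fun w : E => f (normalize w)) ((t • ContinuousLinearMap.id ℝ E) z))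
      ((fderiv ℝ (fun w : E => f (normalize w)) ((t • ContinuousLinearMap.id ℝ E) y)).comp
        (t • ContinuousLinearMap.id ℝ E)) y :=
    hg'.hasFDerivAt.comp y hs
  have h3 : fderiv ℝ (fun z : E => f (normalize z)) y =
      (fderiv ℝ (fun w : E => f (normalize w)) (t • y)).comp (t • ContinuousLinearMap.id ℝ E) := by
    conv_lhs => rw [h1]
    rw [h2.fderiv]
    simp only [smul_apply, ContinuousLinearMap.id_apply]
  rw [h3, ContinuousLinearMap.comp_smul, ContinuousLinearMap.comp_id, smul_smul,
    inv_mul_cancel₀ ht.ne', one_smul]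

variable [CompleteSpace E]

/-- The natural gradient scales like `t⁻¹`: `∇g(t y) = t⁻¹ ∇g(y)` (`t > 0`). -/
theorem gradient_comp_normalize_smul {t : ℝ} (ht : 0 < t) {y : E}
    (hg : DifferentiableAt ℝ (fun z => f (normalize z)) (t • y)) :
    ∇ (fun z => f (normalize z)) (t • y) = t⁻¹ • ∇ (fun z => f (normalize z)) y := by
  simp only [gradient, fderiv_comp_normalize_smul ht hg, map_smul]

/-- **`∇g(y/‖y‖) = ‖y‖ ∇g(y)`** for `y ≠ 0` (the extension of the natural gradient along `ν` picks
up the factor `‖y‖`). -/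
theorem gradient_comp_normalize_normalize {y : E} (hy : y ≠ 0)
    (hg : DifferentiableAt ℝ (fun z => f (normalize z)) (normalize y)) :
    ∇ (fun z => f (normalize z)) (normalize y) = ‖y‖ • ∇ (fun z => f (normalize z)) y := by
  have hn : 0 < ‖y‖ := norm_pos_iff.2 hy
  have h := gradient_comp_normalize_smul (f := f) (inv_pos.2 hn) (y := y) hg
  rw [inv_inv] at h
  exact h

end Homogeneity

/-! ## §2 `div ∘ grad = Δ` for the natural operators on the unit sphere -/

section DivGrad

variable [FiniteDimensional ℝ E] {f : E → ℝ}

/-- The derivative of the gradient field is `(toDual)⁻¹ ∘ D²g`. -/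
theorem hasFDerivAt_gradient {g : E → ℝ} {u : E} (hg : DifferentiableAt ℝ (fderiv ℝ g) u) :
    HasFDerivAt (∇ g) (((toDual ℝ E).symm : StrongDual ℝ E →L[ℝ] E).comp
      (fderiv ℝ (fderiv ℝ g) u)) u :=
  ((toDual ℝ E).symm : StrongDual ℝ E →L[ℝ] E).hasFDerivAt.comp u hg.hasFDerivAt

/-- The trace of `(toDual)⁻¹ ∘ D²g(u)` is the flat Laplacian `Δg(u)`. -/
theorem trace_toDual_symm_comp {g : E → ℝ} (u : E) :
    LinearMap.trace ℝ E (((toDual ℝ E).symm : StrongDual ℝ E →L[ℝ] E).comp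
      (fderiv ℝ (fderiv ℝ g) u)).toLinearMap = Δ g u := by
  rw [LinearMap.trace_eq_sum_inner _ (stdOrthonormalBasis ℝ E),
    laplacian_eq_iteratedFDeriv_orthonormalBasis g (stdOrthonormalBasis ℝ E)]
  refine Finset.sum_congr rfl fun i _ => ?_
  rw [iteratedFDeriv_two_apply, ContinuousLinearMap.coe_coe, ContinuousLinearMap.comp_apply,
    real_inner_comm]
  exact toDual_symm_apply

/-- **`div ∘ grad = Δ` in Engel–Schaefer's extension calculus.**  For `‖u‖ = 1` and `f` of class
`C²` at `u`, with `g = f ∘ ν` the degree-`0` extension: the sphere divergence of the natural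
gradient `∇g` (trace of the derivative of `y ↦ ∇g(y/‖y‖) = ‖y‖ ∇g(y)`) is `Δg(u) = ∂̃·∂̃ f(u)` — the
radial term `⟪u, ∇g(u)⟫` vanishes by Euler's identity. -/
theorem sphereDiv_gradient_comp_normalize {u : E} (hu : ‖u‖ = 1) (hf : ContDiffAt ℝ 2 f u) :
    sphereDiv (∇ (fun z => f (normalize z))) u = Δ (fun z => f (normalize z)) u := by
  have hu0 : u ≠ 0 := by rintro rfl; simp at hu
  have hνu : normalize u = u := normalize_eq_self_of_norm_eq_one hu
  have hf' : ContDiffAt ℝ 2 f (normalize u) := by rwa [hνu]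
  set g : E → ℝ := fun z => f (normalize z) with hgdef
  have hg2 : ContDiffAt ℝ 2 g u := contDiffAt_comp_normalize hu0 hf'
  have hdg : DifferentiableAt ℝ (fderiv ℝ g) u :=
    (hg2.fderiv_right (m := 1) (by norm_num)).differentiableAt (by norm_num)
  -- `g` is differentiable near `u`, hence at `ν y` for `y` near `u`
  have hnear : ∀ᶠ y in 𝓝 u, DifferentiableAt ℝ g y :=
    (hg2.eventually (by simp)).mono fun y hy => hy.differentiableAt (by norm_num)
  have hnear' : ∀ᶠ y in 𝓝 u, DifferentiableAt ℝ g (normalize y) := by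
    have h : ∀ᶠ w in 𝓝 (normalize u), DifferentiableAt ℝ g w := by rwa [hνu]
    exact (contDiffAt_normalize hu0 (n := 1)).continuousAt.eventually h
  have hev : (fun y => ∇ g (normalize y)) =ᶠ[𝓝 u] fun y => ‖y‖ • ∇ g y := by
    filter_upwards [eventually_ne_nhds hu0, hnear'] with y hy hy'
    exact gradient_comp_normalize_normalize hy hy'
  -- the derivative of `y ↦ ‖y‖ • ∇g(y)` at `u`
  have hD : HasFDerivAt (fun y => ‖y‖ • ∇ g y)
      (‖u‖ • (((toDual ℝ E).symm : StrongDual ℝ E →L[ℝ] E).comp (fderiv ℝ (fderiv ℝ g) u)) +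
        ((‖u‖⁻¹ : ℝ) • innerSL ℝ u).smulRight (∇ g u)) u :=
    (hasFDerivAt_norm_of_ne_zero hu0).smul (hasFDerivAt_gradient hdg)
  unfold sphereDiv
  rw [hev.fderiv_eq, hD.fderiv, hu, one_smul, inv_one, one_smul,
    ContinuousLinearMap.toLinearMap_add, map_add, trace_toDual_symm_comp]
  -- the radial rank-one term has trace `⟪u, ∇g(u)⟫ = Dg(u) u = 0`
  have h0 : LinearMap.trace ℝ E ((innerSL ℝ u).smulRight (∇ g u)).toLinearMap = 0 := by
    rw [LinearMap.trace_eq_sum_inner _ (stdOrthonormalBasis ℝ E)]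
    simp only [ContinuousLinearMap.coe_coe, ContinuousLinearMap.smulRight_apply, innerSL_apply_apply,
      inner_smul_right]
    rw [(stdOrthonormalBasis ℝ E).sum_inner_mul_inner u (∇ g u), gradient, real_inner_comm,
      toDual_symm_apply]
    exact fderiv_comp_normalize_apply_self hu0 (hf'.differentiableAt (by norm_num))
  rw [h0, add_zero]

omit [FiniteDimensional ℝ E] in
/-- The sphere divergence is odd: `div(−V) = −div V` (no differentiability needed). -/
theorem sphereDiv_neg (V : E → E) (u : E) : sphereDiv (fun y => -V y) u = -sphereDiv V u := by
  unfold sphereDiv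
  have h : (fun y => (fun y => -V y) (normalize y)) = -(fun y => V (normalize y)) := rfl
  rw [h, fderiv_neg, ContinuousLinearMap.toLinearMap_neg, map_neg]

end DivGrad

/-! ## §3 Sitewise: `div_n (∂̃_n φ) = ∂̃_n·∂̃_n φ`; Lüscher's LO criterion = E–S eq. (15) -/

section Site

variable [FiniteDimensional ℝ E] {Λ : Type*} [DecidableEq Λ]

/-- **Sitewise `div ∘ grad = Δ`**: for a lattice function `φ` of class `C²` in the `n`-th site
variable at `x`, the site divergence of E–S's natural gradient field `∂̃_n φ` is E–S's
`∂̃_n·∂̃_n φ` (`SphereLOFlowAction.siteGrad` / `siteLaplacian`, `SphereLOFlowDivergence.siteDiv`). -/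
theorem siteDiv_siteGrad (n : Λ) (φ : (Λ → E) → ℝ) {x : Λ → E} (hx : ‖x n‖ = 1)
    (hφ : ContDiffAt ℝ 2 (fun y => φ (Function.update x n y)) (x n)) :
    siteDiv n (fun x' => siteGrad n φ x') x = siteLaplacian n φ x := by
  unfold siteDiv siteGrad siteLaplacian
  simp only [Function.update_idem, Function.update_self]
  exact sphereDiv_gradient_comp_normalize (f := fun y => φ (Function.update x n y)) hx hφ

variable [Fintype Λ] {U : Λ → Λ → (E →L[ℝ] E)}

omit [FiniteDimensional ℝ E] in
/-- The leading-order flow action is smooth in each site variable (it is affine in it). -/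
theorem contDiff_loFlowAction_update (hU0 : ∀ n, U n n = 0)
    (hUadj : ∀ m n (v w : E), ⟪U m n v, w⟫ = ⟪v, U n m w⟫) (κ S₀ : ℝ) (x : Λ → E) (n : Λ)
    {k : WithTop ℕ∞} :
    ContDiff ℝ k (fun y => loFlowAction κ S₀ U (Function.update x n y)) := by
  rw [loFlowAction_eq, esAction_update_eq_inner hU0 hUadj]
  exact contDiff_inner_add_const _ _

/-- **Lüscher's criterion at `t = 0` and E–S eq. (15) are one statement**: for the Engel–Schaefer
generator `T_n = −∂̃_n S̃⁽⁰⁾`, `div_n T_n (x) = −∂̃_n·∂̃_n S̃⁽⁰⁾ (x)` on the product of unit spheres. -/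
theorem siteDiv_loGenerator_eq_neg_siteLaplacian (hU0 : ∀ n, U n n = 0)
    (hUadj : ∀ m n (v w : E), ⟪U m n v, w⟫ = ⟪v, U n m w⟫) (κ S₀ : ℝ) {x : Λ → E} {n : Λ}
    (hx : ‖x n‖ = 1) :
    siteDiv n (loGenerator κ S₀ U n) x = -siteLaplacian n (loFlowAction κ S₀ U) x := by
  have h1 : siteDiv n (loGenerator κ S₀ U n) x =
      -siteDiv n (fun x' => siteGrad n (loFlowAction κ S₀ U) x') x := by
    unfold loGenerator siteDiv
    exact sphereDiv_neg _ _
  rw [h1, siteDiv_siteGrad n _ hx (contDiff_loFlowAction_update hU0 hUadj κ S₀ x n).contDiffAt]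

/-- **Consistency**: Lüscher's LO criterion `Σ_n div_n T = S − S₀` re-derived from E–S eq. (15)
(`SphereLOFlowAction.neg_sum_siteLaplacian_loFlowAction`) through `div ∘ grad = Δ` — the same
conclusion as `SphereLOFlowDivergence.sum_siteDiv_loGenerator`, which computed the divergence
directly. -/
theorem sum_siteDiv_loGenerator' (hU0 : ∀ n, U n n = 0)
    (hUadj : ∀ m n (v w : E), ⟪U m n v, w⟫ = ⟪v, U n m w⟫) (hd : 2 ≤ Module.finrank ℝ E)
    (κ S₀ : ℝ) {x : Λ → E} (hx : ∀ n, ‖x n‖ = 1) :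
    ∑ n, siteDiv n (loGenerator κ S₀ U n) x = esAction κ S₀ U x - S₀ := by
  rw [← neg_sum_siteLaplacian_loFlowAction hU0 hUadj hd κ S₀ hx, ← Finset.sum_neg_distrib]
  exact Finset.sum_congr rfl fun n _ => siteDiv_loGenerator_eq_neg_siteLaplacian hU0 hUadj κ S₀ (hx n)

end Site

end Summit.Ventures.LatticeQCDFlow.Exactness

end
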